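import Literature.Topology.FourManifolds.EuclideanRegularDomain

/-!
# Critical points on a compact regular domain `{F ≤ 0} ⊆ ℝ^{m+1}` versus Euclidean derivatives

Topic `Literature/Topology/FourManifolds` (infrastructure for the fact seat
`provefact-Literature.Geometry.Riemannian.LawsonMichelsohn1984_surrounding`: the critical points
of the Morse function of the domain `D = {F ≤ 0}`, an abstract function on the manifold with
boundary `IsRegularCompactDomain.Domain`, have to be read off its smooth extension to `ℝ^{m+1}`,
`IsRegularCompactDomain.exists_contDiff_forall_eq`).  Everything here is **proved**.

* `IsRegularCompactDomain.isMCriticalPt_comp_incl_iff` — for `h : IsRegularCompactDomain F`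
  (`m ≥ 1`) and a `C^∞` function `Φ` on `ℝ^{m+1}`: a point `p` of the domain is a critical point
  of `Φ ∘ incl` (manifold-with-boundary sense, boundary points included) iff `dΦ(incl p) = 0`
  (both are read in the half-slice chart at `p`, whose inverse has onto differential:
  `HalfSliceAtlas.mfderiv_comp_val_eq`, `isMCriticalPt_iff_fderiv_comp_symm_eq_zero`,
  `HalfSpaceCharted.isMCriticalPt_iff'`).

## References

* J. Milnor, *Morse theory* (1963), Thm. 3.1 and §3 (critical points of `f|Mᵃ`). [Milnor1963]
* J. M. Lee, *Introduction to Smooth Manifolds*, 2nd ed. (2013), Prop. 5.47. [LeeSmoothManifolds2013]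
-/

noncomputable section

open Set Function
open scoped Manifold ContDiff

namespace Literature.Topology.FourManifolds

namespace IsRegularCompactDomain

open HalfSpaceCharted

variable {m : ℕ} {F : EuclideanSpace ℝ (Fin (m + 1)) → ℝ}

/-- **Critical points of a restriction to the domain are the zeros of the Euclidean
differential**: for a `C^∞` function `Φ` on `ℝ^{m+1}` and a point `p` of the compact regular
domain `{F ≤ 0}` (`m ≥ 1`), `Φ ∘ incl` is critical at `p` iff `dΦ(incl p) = 0`.
[cite: Milnor1963, Thm. 3.1] -/
theorem isMCriticalPt_comp_incl_iff (h : IsRegularCompactDomain F) (hm : 1 ≤ m)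
    {Φ : EuclideanSpace ℝ (Fin (m + 1)) → ℝ} (hΦ : ContDiff ℝ ∞ Φ) (p : h.Domain) :
    IsMCriticalPt (𝓡∂ (m + 1)) (Φ ∘ Domain.incl h) p ↔ fderiv ℝ Φ (Domain.incl h p) = 0 := by
  -- the ambient synonym and the function read on it
  set Φ' : HalfSpaceCharted (EuclideanSpace ℝ (Fin (m + 1))) → ℝ :=
    Φ ∘ (of (X := EuclideanSpace ℝ (Fin (m + 1)))).symm with hΦ'
  set ι : h.Domain → HalfSpaceCharted (EuclideanSpace ℝ (Fin (m + 1))) :=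
    (Subtype.val : ↥((F ∘ (of (X := EuclideanSpace ℝ (Fin (m + 1)))).symm) ⁻¹' Iic 0) → _)
    with hι
  have hcomp : Φ ∘ Domain.incl h = Φ' ∘ ι := rfl
  -- the half-slice chart at `p` is `(h.atlas.datum p).Θ`
  have hps : p.1 ∈ (h.atlas.datum p).Θ.source := h.atlas.mem_source p
  -- smoothness of `Φ' ∘ Θ.symm` on the target
  have hsymm : ContDiffOn ℝ ∞ (Φ' ∘ (h.atlas.datum p).Θ.symm) (h.atlas.datum p).Θ.target := by
    have h1 : ContMDiffOn 𝓘(ℝ, EuclideanSpace ℝ (Fin (m + 1))) (𝓡 (m + 1)) ∞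
        ((of (X := EuclideanSpace ℝ (Fin (m + 1)))).symm ∘ (h.atlas.datum p).Θ.symm)
        (h.atlas.datum p).Θ.target :=
      Domain.contMDiff_of_symm.comp_contMDiffOn (h.atlas.datum p).contMDiffOn_symm
    have h2 := hΦ.contMDiff.comp_contMDiffOn h1
    exact contMDiffOn_iff_contDiffOn.1 h2
  have hdiff : DifferentiableAt ℝ (Φ' ∘ (h.atlas.datum p).Θ.symm) ((h.atlas.datum p).Θ p.1) :=
    (hsymm.contDiffAt ((h.atlas.datum p).Θ.open_target.mem_nhds
      ((h.atlas.datum p).Θ.map_source hps))).differentiableAt (by simp)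
  -- the restriction is smooth
  have hres : ContMDiff (𝓡∂ (m + 1)) 𝓘(ℝ, ℝ) ∞ (Φ' ∘ ι) := by
    rw [← hcomp]; exact hΦ.contMDiff.comp (Domain.contMDiff_incl h hm)
  have hmf := h.atlas.mfderiv_comp_val_eq Φ' p (hres.mdifferentiableAt (by simp)) hdiff
  -- `Φ'` on the ambient synonym is differentiable
  have hΦ'c : ContMDiff (𝓡∂ (m + 1)) 𝓘(ℝ, ℝ) ∞ Φ' := contMDiff_iff.2 hΦ.contMDiff
  have hcrit := isMCriticalPt_iff_fderiv_comp_symm_eq_zero (I := 𝓡∂ (m + 1))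
    (h.atlas.datum p).contMDiffOn_toFun (h.atlas.datum p).contMDiffOn_symm hps
    (hΦ'c.mdifferentiableAt (by simp))
  have hmf' : mfderiv (𝓡∂ (m + 1)) 𝓘(ℝ, ℝ) (Φ' ∘ ι) p =
      fderiv ℝ (Φ' ∘ (h.atlas.datum p).Θ.symm) ((h.atlas.datum p).Θ p.1) := hmf
  -- assemble
  rw [hcomp]
  show mfderiv (𝓡∂ (m + 1)) 𝓘(ℝ, ℝ) (Φ' ∘ ι) p = 0 ↔ _
  rw [hmf']
  refine hcrit.symm.trans ?_
  rw [isMCriticalPt_iff']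
  show mfderiv (𝓡 (m + 1)) 𝓘(ℝ, ℝ) Φ (of.symm p.1) = 0 ↔ _
  rw [_root_.mfderiv_eq_fderiv]
  rfl

/-- The critical set of a restriction to the domain is the preimage of the zero set of the
Euclidean differential. [cite: Milnor1963, Thm. 3.1] -/
theorem criticalSet_comp_incl_eq (h : IsRegularCompactDomain F) (hm : 1 ≤ m)
    {Φ : EuclideanSpace ℝ (Fin (m + 1)) → ℝ} (hΦ : ContDiff ℝ ∞ Φ) :
    criticalSet (𝓡∂ (m + 1)) (Φ ∘ Domain.incl h) =
      Domain.incl h ⁻¹' {x | fderiv ℝ Φ x = 0} := by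
  ext p
  rw [mem_criticalSet, h.isMCriticalPt_comp_incl_iff hm hΦ]
  rfl

end IsRegularCompactDomain

end Literature.Topology.FourManifolds

end
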